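import Summits.ResolutionOfSingularities.KangarooAtlas.MizutaniGroupScheme
import Summits.ResolutionOfSingularities.KangarooAtlas.MizutaniOdaEquality
import HarnessLib

/-!
# Oda's subscheme of invariant additive forms IS `B_{P,𝔭}`: `schemeIdeal k p 𝔭 = U_+(𝔭)S`; the points of `B_{P,𝔭}` as a submodule

Cell `pub-rosobs`, Mizutani enclosure (seat mizutani-encloser-2, gen 5). AI-written; AI review is weaker than expert
review; NOT a resolution-of-singularities theorem (summit relevance C).

Two book-keeping consequences of encloser-1 g4's Oda equality `hirForms_eq_invForms` (Oda 1973 Prop. 2.2 (ii),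
`MizutaniOdaEquality.lean`) and of `MizutaniGroupScheme.lean`:

* **`schemeIdeal_eq_bIdeal`** — for every point `𝔭` of `ℙ^n_k`, the ideal generated by ALL of Oda's invariant additive forms
  (`schemeIdeal k p 𝔭`, gen 4, whose quotient has Krull dimension `hsDim`) IS Hironaka's `U_+(𝔭)S` (`bIdeal k 𝔭`): the two
  vocabularies define THE SAME closed subscheme `B(𝔭) = B_{P,𝔭} ⊆ 𝔸^{n+1}`, not merely schemes of the same dimension;
* **`pointsSubmodule`** — for every commutative `k`-algebra `k'`, the `k'`-points `B_{P,𝔭}(k') = {v ∈ (k')^{n+1} : f(v) = 0 ∀ f ∈ U_+(𝔭)S}`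
  form a `k'`-SUBMODULE of `(k')^{n+1}` (a subgroup stable under all scalars: `bIdeal_aeval_add/smul/zero`), `mem_pointsSubmodule_iff`,
  and `pointsSubmodule_eq_ridge` (its underlying additive monoid is Giraud's ridge functor of `B_{P,𝔭}` at `k'`).

## References

* T. Oda, *Hironaka's additive group scheme. II*, Publ. RIMS 19 (1983), §2 p. 1168 (B ↔ L_B). [Oda1983HironakaGroupSchemeII]
* H. Mizutani, *Hironaka's additive group schemes*, Nagoya Math. J. 52 (1973), Def. 1.1, Thm. 1.3. [Mizutani1973HironakaGroupSchemes]
-/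

noncomputable section

open MvPolynomial Literature.AlgebraicGeometry.Resolution Literature.AlgebraicGeometry.Resolution.HironakaScheme

namespace Summit.ResolutionOfSingularities.KangarooAtlas.Mizutani

universe u v

section Identity

variable (k : Type u) [Field k] (p : ℕ) [hp : Fact p.Prime] [CharP k p] {n : ℕ}
  (𝔭 : Ideal (MvPolynomial (Fin (n + 1)) k))

/-- **Oda's scheme of invariant additive forms is `B_{P,𝔭}`**: `schemeIdeal k p 𝔭 = U_+(𝔭)S` for every point `𝔭` of `ℙ^n_k`
(`(L_B)_e = U(𝔭) ∩ L_e` for all `e`, and `U_+(𝔭)S` is generated by the additive forms of `U(𝔭)`).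
[cite: Oda1983HironakaGroupSchemeII, §2 (p. 1168); Mizutani1973HironakaGroupSchemes, Def. 1.1 and Thm. 1.3] -/
theorem schemeIdeal_eq_bIdeal [𝔭.IsPrime] (hP : IsPoint k 𝔭) : schemeIdeal k p 𝔭 = bIdeal k 𝔭 := by
  have h : invForms k p 𝔭 = hirForms k p 𝔭 := funext fun e => (hirForms_eq_invForms 𝔭 e).symm
  rw [schemeIdeal, h, bIdeal_eq_famIdeal_hirForms_holds k p 𝔭 hP]

/-- Hence the two quotients are the same ring: `S ⧸ schemeIdeal = S ⧸ U_+(𝔭)S` (as ideals coincide), in particular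
`ringKrullDim (S ⧸ schemeIdeal k p 𝔭) = ringKrullDim (S ⧸ bIdeal k 𝔭)` with no appeal to the dimension formulas.
[cite: Mizutani1973HironakaGroupSchemes, Thm. 1.3] -/
theorem ringKrullDim_quotient_schemeIdeal_eq_bIdeal [𝔭.IsPrime] (hP : IsPoint k 𝔭) :
    ringKrullDim (MvPolynomial (Fin (n + 1)) k ⧸ schemeIdeal k p 𝔭) =
      ringKrullDim (MvPolynomial (Fin (n + 1)) k ⧸ bIdeal k 𝔭) := by
  rw [schemeIdeal_eq_bIdeal k p 𝔭 hP]

end Identity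

section Points

variable (k : Type u) [Field k] (p : ℕ) [hp : Fact p.Prime] [CharP k p] {n : ℕ}
  (𝔭 : Ideal (MvPolynomial (Fin (n + 1)) k)) (k' : Type v) [CommRing k'] [Algebra k k']

/-- **The `k'`-points of `B_{P,𝔭}` as a `k'`-submodule of `(k')^{n+1}`**: `{v | f(v) = 0 for all f ∈ U_+(𝔭)S}` is closed under `0`, `+`
and all scalars of `k'` (for a point `𝔭`; `MizutaniGroupScheme.bIdeal_aeval_zero/add/smul`).
[cite: Mizutani1973HironakaGroupSchemes, Def. 1.1 ("a homogeneous additive subgroup scheme of the vector group Spec(S)")] -/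
def pointsSubmodule [𝔭.IsPrime] (hP : IsPoint k 𝔭) : Submodule k' (Fin (n + 1) → k') where
  carrier := {v | ∀ f ∈ bIdeal k 𝔭, aeval v f = 0}
  zero_mem' := bIdeal_aeval_zero k p 𝔭 hP
  add_mem' hv hw := bIdeal_aeval_add k p 𝔭 hP hv hw
  smul_mem' c _ hv := bIdeal_aeval_smul k p 𝔭 hP c hv

/-- Membership in `pointsSubmodule`. [cite: Mizutani1973HironakaGroupSchemes, Def. 1.1] -/
theorem mem_pointsSubmodule_iff [𝔭.IsPrime] (hP : IsPoint k 𝔭) {v : Fin (n + 1) → k'} :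
    v ∈ pointsSubmodule k p 𝔭 k' hP ↔ ∀ f ∈ bIdeal k 𝔭, aeval v f = 0 :=
  Iff.rfl

/-- The additive monoid underlying `pointsSubmodule` is Giraud's ridge functor of `B_{P,𝔭}` at `k'` (`B_{P,𝔭}` is its own ridge).
[cite: Mizutani1973HironakaGroupSchemes, Def. 1.1] -/
theorem pointsSubmodule_eq_ridge [𝔭.IsPrime] (hP : IsPoint k 𝔭) :
    (pointsSubmodule k p 𝔭 k' hP).toAddSubmonoid = ridge k' (bIdeal k 𝔭) := by
  ext v
  rw [Submodule.mem_toAddSubmonoid, mem_pointsSubmodule_iff, mem_ridge_bIdeal_iff k p 𝔭 hP]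

/-- Oda's and Hironaka's subschemes have the same points in every `k'`. [cite: Oda1983HironakaGroupSchemeII, §2 (p. 1168)] -/
theorem forall_aeval_schemeIdeal_iff [𝔭.IsPrime] (hP : IsPoint k 𝔭) {v : Fin (n + 1) → k'} :
    (∀ f ∈ schemeIdeal k p 𝔭, aeval v f = 0) ↔ v ∈ pointsSubmodule k p 𝔭 k' hP := by
  rw [mem_pointsSubmodule_iff, schemeIdeal_eq_bIdeal k p 𝔭 hP]

end Points

end Summit.ResolutionOfSingularities.KangarooAtlas.Mizutani

end
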